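import Mathlib
import Summits.NavierStokesRegularity.NavierStokesRegularity.Theorems.EulerZoomLiouvillePowerGaugeEulerLiouvilleSelfSimilarBernoulliSqueezeMember
import Summits.NavierStokesRegularity.NavierStokesRegularity.Theorems.EulerZoomLiouvillePowerGaugeEulerLiouvilleSelfSimilarBernoulliSqueezeSharp
import Summits.NavierStokesRegularity.NavierStokesRegularity.Theorems.EulerZoomLiouvillePowerGaugeEulerLiouvilleSelfSimilarBernoulliSqueezeVortical
import Summits.NavierStokesRegularity.NavierStokesRegularity.Theorems.EulerZoomLiouvillePowerGaugeEulerLiouvilleSelfSimilarPastProfilePressure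
import Summits.NavierStokesRegularity.NavierStokesRegularity.Theorems.EulerZoomLiouvillePowerGaugeEulerLiouvilleSelfSimilarPastExtension
import Summits.NavierStokesRegularity.NavierStokesRegularity.Theorems.EulerZoomLiouvillePowerGaugeEulerLiouvilleSelfSimilarPastStrata
import HarnessLib

/-!
# «SUPER-FAST VORTICAL CHANNELS SQUEEZE VOLUME TOO FAST» — the SHARP past-exact / shifted twin (vortical-set form, no far-field pressure hypothesis)
# (crux `EulerZoomLiouville.PowerGaugeEulerLiouville` = stmt-NavierStokesRegularity-19832, line `birth`, THE ONE STATEMENT)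

Route №10 `EulerZoomLiouville` (NavierStokesRegularity); width seat ns-ezl-w5 g0.  Fifth file of the (C2) volume-squeeze chain: the past twin of
`Loc.selfSimilar_ae_eq_zero_of_vorticalSuperFastChannelC2_profile` (…SqueezeVorticalMember; channel bound asked only at VORTICAL far high points).  The past dictionary gives the pressure profile only in GROWTH form
(`Past.profile_pressure_growth_of_gaugeD_past`: `∫_{B_L}|P|^{3/2} ≤ C L^{2−2ρ}` for `L ≥ 2 − T₁`), so the thinness of the high Bernoulli sets is re-derived
here from growth-form data:

* `Loc.norm_ge_of_bernoulliHigh_of_pressure_le` — POINTWISE: `0 < γ < ½`, `‖y‖ ≥ R₃(h,γ)`, `P(y) ≤ (γ(1−2γ)/4)‖y‖²` and `ℋ(y) > h` force `‖V y‖ ≥ a_γ‖y‖`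
  (`a_γ = (√(γ/2) − γ)/2`); hence far out `{ℋ > h} ⊆ {‖V‖ ≥ a_γ‖y‖} ∪ {P > (γ(1−2γ)/4)‖y‖²}`;
* `Loc.volume_pressureHigh_inter_shell_le` / `Loc.volume_pressureHigh_inter_far_le` — Chebyshev: `vol({P > b‖y‖²} ∩ {L ≤ ‖y‖ ≤ 2L}) ≤ C′L^{−1−2ρ}` from the
  growth form, and the dyadic tail;
* `Loc.volume_bernoulliHigh_inter_far_le_of_growth` — thinness with rate `1+2ρ` of every high set from `A`-growth + pressure growth (both in growth form);
* `Past.profile_eq_zero_of_vorticalSuperFastChannelC2` / **`Past.selfSimilar_ae_eq_zero_of_vorticalSuperFastChannelC2_profile_past`** — a class member (`0 < ρ ≤ ½`) exactly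
  self-similar about `(T, x₀)` for `τ < T₁` (`T₁ ≤ 0`, `T₁ ≤ T`) whose `C²` velocity profile has linear growth and, for every classical pressure `P′`, a far
  SUPER-fast channel (`c₁ > 3/((2+ρ)(1+2ρ))`) at the VORTICAL far points of every high set `{ℋ_{P′} > h}` is trivial — bridge `P = P′ + c₀` a.e. on the far-past extension
  (`WeakToClassical.pressureProfile_ae_eq_add_const`), thinness of `{ℋ_P > h + c₀}`, vortical squeeze `Loc.curl_eq_zero_of_vorticalFastChannel_of_thin`, irrotational past stratum.

HONEST LABEL: partial model-class stratum (linear growth; super-fast far channels).  WHAT THIS IS NOT: not NS, not E — classical sub-strata `--supports`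
stmt-19832 on the MODEL lattice (E/NS strata); 19832 OPEN; NS regularity NOT proved. [folklore; ConstantinIgnatovaVicol2026Putative §3.4]
-/

noncomputable section

-- flat `Theorems/<Route><Decl>…` files of one crux share the namespace of the crux (tree convention)
set_option linter.dupNamespace false

open MeasureTheory Set Filter Topology Metric Function InnerProductSpace TopologicalSpace
open scoped RealInnerProductSpace NNReal ENNReal ContDiff

namespace Summit.NavierStokesRegularity.NavierStokesRegularity.Theorems.PowerGaugeEulerLiouville

open Literature.Analysis Literature.Analysis.FluidPDE Literature.Analysis.FunctionSpaces
open Summit.NavierStokesRegularity.NavierStokesRegularity.Theorems.PowerGaugeEulerLiouville.BernoulliThinness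

/-! ### Pointwise: a Bernoulli-high point with small pressure is a fast point -/

/-- **Pointwise form of `Loc.bernoulliHigh_subset_fastSet_of_pressure_le`**: `0 < γ < ½`; for every `h` there is `R₃` such that at any `y` with
`‖y‖ ≥ R₃`, `P(y) ≤ (γ(1−2γ)/4)‖y‖²` and `ℋ(y) > h` one has `‖V y‖ ≥ a_γ‖y‖`, `a_γ = (√(γ/2) − γ)/2`. [folklore] -/
theorem Loc.norm_ge_of_bernoulliHigh_of_pressure_le {γ : ℝ} (hγ : 0 < γ) (hγ2 : γ < 1 / 2)
    (V : EuclideanSpace ℝ (Fin 3) → EuclideanSpace ℝ (Fin 3)) (P : EuclideanSpace ℝ (Fin 3) → ℝ) (h : ℝ) :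
    ∃ R₃ : ℝ, ∀ y : EuclideanSpace ℝ (Fin 3), R₃ ≤ ‖y‖ → P y ≤ γ * (1 - 2 * γ) / 4 * ‖y‖ ^ 2 →
      h < selfSimilarBernoulli γ 0 V P y → (Real.sqrt (γ / 2) - γ) / 2 * ‖y‖ ≤ ‖V y‖ := by
  -- the pressure cap `min (P y) (γ(1−2γ)/4 ‖y‖²)` is globally unpressurised and agrees with `P` at the points under study
  set Pc : EuclideanSpace ℝ (Fin 3) → ℝ := fun y => min (P y) (γ * (1 - 2 * γ) / 4 * ‖y‖ ^ 2) with hPc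
  obtain ⟨R₃, hR₃⟩ := Loc.bernoulliHigh_subset_fastSet_of_pressure_le (V := V) (P := Pc) (R₁ := 0) hγ hγ2 le_rfl
    (fun y _ => min_le_right _ _) h
  refine ⟨R₃, fun y hy hPy hH => hR₃ y hy ?_⟩
  have hPcy : Pc y = P y := by rw [hPc]; exact min_eq_left hPy
  simp only [selfSimilarBernoulli_apply] at hH ⊢
  rw [hPcy]
  exact hH

/-! ### The pressurised set is thin (growth form of the `D`-data) -/

/-- **Chebyshev for the pressurised set on a dyadic shell**: `∫_{B_L}|P|^{3/2} ≤ C L^{2−2ρ}` for `L ≥ L₁` and `b > 0` give, for `L ≥ L₁` (`L > 0`),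
`vol({b‖y‖² < P y} ∩ {L ≤ ‖y‖ ≤ 2L}) ≤ (C 3^{2−2ρ}/b^{3/2}) L^{−1−2ρ}`. [folklore] -/
theorem Loc.volume_pressureHigh_inter_shell_le {ρ : ℝ}
    {P : EuclideanSpace ℝ (Fin 3) → ℝ} (hPm : AEStronglyMeasurable P volume) {C : ℝ≥0} {L₁ : ℝ}
    (hD : ∀ L : ℝ, L₁ ≤ L → ∫⁻ y in ball (0 : EuclideanSpace ℝ (Fin 3)) L, ‖P y‖ₑ ^ (3 / 2 : ℝ) ≤
      C * ENNReal.ofReal (L ^ (2 - 2 * ρ)))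
    {b : ℝ} (hb : 0 < b) {L : ℝ} (hL : 0 < L) (hL₁ : L₁ ≤ 3 * L) :
    volume ({y : EuclideanSpace ℝ (Fin 3) | b * ‖y‖ ^ 2 < P y} ∩ {y | L ≤ ‖y‖ ∧ ‖y‖ ≤ 2 * L}) ≤
      ENNReal.ofReal ((C : ℝ) * (3 : ℝ) ^ (2 - 2 * ρ) / b ^ (3 / 2 : ℝ) * L ^ (-1 - 2 * ρ)) := by
  -- adapted from `Loc.volume_fastSet_inter_shell_le` (…SelfSimilarBernoulliSqueezeMember)
  set g : EuclideanSpace ℝ (Fin 3) → ℝ≥0∞ :=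
    (ball (0 : EuclideanSpace ℝ (Fin 3)) (3 * L)).indicator fun y => ‖P y‖ₑ ^ (3 / 2 : ℝ) with hg
  have hgm : AEMeasurable g volume := (hPm.aemeasurable.enorm.pow_const _).indicator measurableSet_ball
  have hgint : ∫⁻ y, g y = ∫⁻ y in ball (0 : EuclideanSpace ℝ (Fin 3)) (3 * L), ‖P y‖ₑ ^ (3 / 2 : ℝ) := by
    rw [hg, lintegral_indicator measurableSet_ball]
  set lam : ℝ≥0∞ := ENNReal.ofReal ((b * L ^ 2) ^ (3 / 2 : ℝ)) with hlam
  have hlam0 : lam ≠ 0 := (ENNReal.ofReal_pos.2 (by positivity)).ne'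
  have hS : ∀ y ∈ {y : EuclideanSpace ℝ (Fin 3) | b * ‖y‖ ^ 2 < P y} ∩ {y | L ≤ ‖y‖ ∧ ‖y‖ ≤ 2 * L}, lam ≤ g y := by
    rintro y ⟨hy, hyL, hy2L⟩
    have hyball : y ∈ ball (0 : EuclideanSpace ℝ (Fin 3)) (3 * L) := by
      rw [mem_ball_zero_iff]; linarith
    have hPpos : 0 < P y := lt_of_le_of_lt (by positivity) hy
    rw [hg, indicator_of_mem hyball, hlam, Real.enorm_eq_ofReal hPpos.le, ENNReal.ofReal_rpow_of_nonneg hPpos.le (by norm_num)]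
    refine ENNReal.ofReal_le_ofReal (Real.rpow_le_rpow (by positivity) ?_ (by norm_num))
    have h1 : b * L ^ 2 ≤ b * ‖y‖ ^ 2 := mul_le_mul_of_nonneg_left (pow_le_pow_left₀ hL.le hyL 2) hb.le
    exact le_of_lt (lt_of_le_of_lt h1 hy)
  calc volume ({y : EuclideanSpace ℝ (Fin 3) | b * ‖y‖ ^ 2 < P y} ∩ {y | L ≤ ‖y‖ ∧ ‖y‖ ≤ 2 * L})
      ≤ (∫⁻ y, g y) / lam := measure_le_lintegral_div hgm hlam0 ENNReal.ofReal_ne_top hS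
    _ ≤ (C * ENNReal.ofReal ((3 * L) ^ (2 - 2 * ρ))) / lam := by
        rw [hgint]; exact ENNReal.div_le_div_right (hD (3 * L) hL₁) _
    _ = ENNReal.ofReal ((C : ℝ) * (3 : ℝ) ^ (2 - 2 * ρ) / b ^ (3 / 2 : ℝ) * L ^ (-1 - 2 * ρ)) := by
        rw [hlam, ← ENNReal.ofReal_coe_nnreal, ← ENNReal.ofReal_mul (NNReal.coe_nonneg _),
          ← ENNReal.ofReal_div_of_pos (by positivity)]
        congr 1
        have e1 : (3 * L) ^ (2 - 2 * ρ) = (3 : ℝ) ^ (2 - 2 * ρ) * L ^ (2 - 2 * ρ) := Real.mul_rpow (by norm_num) hL.le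
        have e2 : (b * L ^ 2) ^ (3 / 2 : ℝ) = b ^ (3 / 2 : ℝ) * L ^ (3 : ℝ) := by
          rw [Real.mul_rpow hb.le (by positivity), show L ^ 2 = L ^ (2 : ℝ) by norm_cast, ← Real.rpow_mul hL.le]
          norm_num
        have e3 : L ^ (-1 - 2 * ρ) = L ^ (2 - 2 * ρ) * (L ^ (3 : ℝ))⁻¹ := by
          rw [show (-1 - 2 * ρ) = (2 - 2 * ρ) + (-3 : ℝ) by ring, Real.rpow_add hL, Real.rpow_neg hL.le]
        rw [e1, e2, e3]
        have hL3 : 0 < L ^ (3 : ℝ) := Real.rpow_pos_of_pos hL _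
        have hb3 : 0 < b ^ (3 / 2 : ℝ) := Real.rpow_pos_of_pos hb _
        field_simp

/-- **The pressurised set has a polynomial tail** (growth form): `vol({b‖y‖² < P y} ∩ {‖y‖ ≥ R}) ≤ C″ R^{−1−2ρ}` for `R ≥ max L₁ 1` (`ρ > 0`). [folklore] -/
theorem Loc.volume_pressureHigh_inter_far_le {ρ : ℝ} (hρ : 0 < ρ)
    {P : EuclideanSpace ℝ (Fin 3) → ℝ} (hPm : AEStronglyMeasurable P volume) {C : ℝ≥0} {L₁ : ℝ}
    (hD : ∀ L : ℝ, L₁ ≤ L → ∫⁻ y in ball (0 : EuclideanSpace ℝ (Fin 3)) L, ‖P y‖ₑ ^ (3 / 2 : ℝ) ≤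
      C * ENNReal.ofReal (L ^ (2 - 2 * ρ)))
    {b : ℝ} (hb : 0 < b) :
    ∃ C'' : ℝ, ∀ R : ℝ, max L₁ 1 ≤ R →
      volume ({y : EuclideanSpace ℝ (Fin 3) | b * ‖y‖ ^ 2 < P y} ∩ {y | R ≤ ‖y‖}) ≤ ENNReal.ofReal (C'' * R ^ (-1 - 2 * ρ)) := by
  -- adapted from `Loc.volume_fastSet_inter_far_le` (…SelfSimilarBernoulliSqueezeMember)
  set C' : ℝ := (C : ℝ) * (3 : ℝ) ^ (2 - 2 * ρ) / b ^ (3 / 2 : ℝ) with hC'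
  refine ⟨|C'| * (1 - (2 : ℝ) ^ (-1 - 2 * ρ))⁻¹, fun R hR => ?_⟩
  have hRpos : 0 < R := lt_of_lt_of_le one_pos ((le_max_right _ _).trans hR)
  have hRL₁ : L₁ ≤ R := (le_max_left _ _).trans hR
  set Θ : Set (EuclideanSpace ℝ (Fin 3)) := {y | b * ‖y‖ ^ 2 < P y} with hΘ
  set Sh : ℕ → Set (EuclideanSpace ℝ (Fin 3)) :=
    fun k => Θ ∩ {y | 2 ^ k * R ≤ ‖y‖ ∧ ‖y‖ ≤ 2 * (2 ^ k * R)} with hSh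
  have hcover : Θ ∩ {y | R ≤ ‖y‖} ⊆ ⋃ k : ℕ, Sh k := by
    rintro y ⟨hy, hyR⟩
    have h1 : 1 ≤ ‖y‖ / R := by rw [le_div_iff₀ hRpos]; simpa using hyR
    obtain ⟨k, hk1, hk2⟩ := exists_nat_pow_near h1 one_lt_two
    refine mem_iUnion.mpr ⟨k, hy, ?_, ?_⟩
    · have := (le_div_iff₀ hRpos).mp hk1
      linarith
    · have := (div_lt_iff₀ hRpos).mp hk2
      rw [pow_succ] at this
      linarith
  have hSk : ∀ k : ℕ, volume (Sh k) ≤ ENNReal.ofReal (C' * (2 ^ k * R) ^ (-1 - 2 * ρ)) := by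
    intro k
    have h2k : (1 : ℝ) ≤ 2 ^ k := one_le_pow₀ one_le_two
    have hkR : 0 < 2 ^ k * R := by positivity
    refine Loc.volume_pressureHigh_inter_shell_le hPm hD hb hkR ?_
    nlinarith
  calc volume (Θ ∩ {y | R ≤ ‖y‖}) ≤ volume (⋃ k : ℕ, Sh k) := measure_mono hcover
    _ ≤ ∑' k : ℕ, volume (Sh k) := measure_iUnion_le _
    _ ≤ ∑' k : ℕ, ENNReal.ofReal (C' * (2 ^ k * R) ^ (-1 - 2 * ρ)) := ENNReal.tsum_le_tsum hSk
    _ ≤ ENNReal.ofReal (|C'| * (1 - (2 : ℝ) ^ (-1 - 2 * ρ))⁻¹ * R ^ (-1 - 2 * ρ)) :=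
        tsum_ofReal_mul_two_pow_mul_rpow_le C' hRpos (by linarith)

/-! ### Thinness of the high Bernoulli sets from growth-form data -/

/-- **The high Bernoulli sets are thin with rate `1+2ρ`, from growth-form data** (`0 < ρ`, `γ = 1/(2+ρ)`): `A`-growth `∫_{B_L}|V|² ≤ c L^{1−2ρ}` (all `L>0`)
and pressure growth `∫_{B_L}|P|^{3/2} ≤ C L^{2−2ρ}` (`L ≥ L₁`) give, for every `h`, `C_h, R₂ > 0` with `vol({ℋ > h} ∩ {‖y‖ ≥ R}) ≤ C_h R^{−(1+2ρ)}` for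
`R ≥ R₂`. [folklore] -/
theorem Loc.volume_bernoulliHigh_inter_far_le_of_growth {ρ : ℝ} (hρ : 0 < ρ)
    {V : EuclideanSpace ℝ (Fin 3) → EuclideanSpace ℝ (Fin 3)} (hVm : AEStronglyMeasurable V volume) {c : ℝ≥0}
    (hA : ∀ L : ℝ, 0 < L → ∫⁻ y in ball (0 : EuclideanSpace ℝ (Fin 3)) L, ‖V y‖ₑ ^ 2 ≤ c * ENNReal.ofReal (L ^ (1 - 2 * ρ)))
    {P : EuclideanSpace ℝ (Fin 3) → ℝ} (hPm : AEStronglyMeasurable P volume) {C : ℝ≥0} {L₁ : ℝ}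
    (hD : ∀ L : ℝ, L₁ ≤ L → ∫⁻ y in ball (0 : EuclideanSpace ℝ (Fin 3)) L, ‖P y‖ₑ ^ (3 / 2 : ℝ) ≤
      C * ENNReal.ofReal (L ^ (2 - 2 * ρ))) (h : ℝ) :
    ∃ Ch R₂ : ℝ, 0 < R₂ ∧ ∀ R : ℝ, R₂ ≤ R →
      volume ({y : EuclideanSpace ℝ (Fin 3) | h < selfSimilarBernoulli (1 / (2 + ρ)) 0 V P y} ∩ {y | R ≤ ‖y‖}) ≤
        ENNReal.ofReal (Ch * R ^ (-(1 + 2 * ρ))) := by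
  have h2ρ : (0 : ℝ) < 2 + ρ := by linarith
  have hγ : (0 : ℝ) < 1 / (2 + ρ) := one_div_pos.2 h2ρ
  have hγ2 : 1 / (2 + ρ) < 1 / 2 := one_div_lt_one_div_of_lt two_pos (by linarith)
  set a : ℝ := (Real.sqrt ((1 / (2 + ρ)) / 2) - 1 / (2 + ρ)) / 2 with hadef
  have hsq : 1 / (2 + ρ) < Real.sqrt ((1 / (2 + ρ)) / 2) := by
    rw [Real.lt_sqrt hγ.le]; nlinarith
  have ha : 0 < a := by rw [hadef]; linarith
  set b : ℝ := (1 / (2 + ρ)) * (1 - 2 * (1 / (2 + ρ))) / 4 with hbdef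
  have hb : 0 < b := by rw [hbdef]; nlinarith
  obtain ⟨C₁, hfast⟩ := Loc.volume_fastSet_inter_far_le hρ hVm hA ha
  obtain ⟨C₂, hpress⟩ := Loc.volume_pressureHigh_inter_far_le hρ hPm hD hb
  obtain ⟨R₃, hR₃⟩ := Loc.norm_ge_of_bernoulliHigh_of_pressure_le hγ hγ2 V P h
  refine ⟨max C₁ 0 + max C₂ 0, max (max R₃ L₁) 1, by positivity, fun R hR => ?_⟩
  have hRpos : 0 < R := lt_of_lt_of_le one_pos ((le_max_right _ _).trans hR)
  have hRR₃ : R₃ ≤ R := ((le_max_left _ _).trans (le_max_left _ _)).trans hR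
  have hRL : max L₁ 1 ≤ R := max_le (((le_max_right _ _).trans (le_max_left _ _)).trans hR) ((le_max_right _ _).trans hR)
  -- the split
  have hsplit : {y : EuclideanSpace ℝ (Fin 3) | h < selfSimilarBernoulli (1 / (2 + ρ)) 0 V P y} ∩ {y | R ≤ ‖y‖} ⊆
      ({y : EuclideanSpace ℝ (Fin 3) | a * ‖y‖ ≤ ‖V y‖} ∩ {y | R ≤ ‖y‖}) ∪
        ({y : EuclideanSpace ℝ (Fin 3) | b * ‖y‖ ^ 2 < P y} ∩ {y | R ≤ ‖y‖}) := by
    rintro y ⟨hy, hyR⟩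
    by_cases hPy : P y ≤ b * ‖y‖ ^ 2
    · exact Or.inl ⟨hR₃ y (hRR₃.trans hyR) hPy hy, hyR⟩
    · exact Or.inr ⟨not_le.1 hPy, hyR⟩
  have hRneg : 0 ≤ R ^ (-1 - 2 * ρ) := Real.rpow_nonneg hRpos.le _
  calc volume ({y : EuclideanSpace ℝ (Fin 3) | h < selfSimilarBernoulli (1 / (2 + ρ)) 0 V P y} ∩ {y | R ≤ ‖y‖})
      ≤ volume ({y : EuclideanSpace ℝ (Fin 3) | a * ‖y‖ ≤ ‖V y‖} ∩ {y | R ≤ ‖y‖}) +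
          volume ({y : EuclideanSpace ℝ (Fin 3) | b * ‖y‖ ^ 2 < P y} ∩ {y | R ≤ ‖y‖}) :=
        (measure_mono hsplit).trans (measure_union_le _ _)
    _ ≤ ENNReal.ofReal (C₁ * R ^ (-1 - 2 * ρ)) + ENNReal.ofReal (C₂ * R ^ (-1 - 2 * ρ)) :=
        add_le_add (hfast R hRpos) (hpress R hRL)
    _ ≤ ENNReal.ofReal (max C₁ 0 * R ^ (-1 - 2 * ρ)) + ENNReal.ofReal (max C₂ 0 * R ^ (-1 - 2 * ρ)) :=
        add_le_add (ENNReal.ofReal_le_ofReal (mul_le_mul_of_nonneg_right (le_max_left _ _) hRneg))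
          (ENNReal.ofReal_le_ofReal (mul_le_mul_of_nonneg_right (le_max_left _ _) hRneg))
    _ = ENNReal.ofReal ((max C₁ 0 + max C₂ 0) * R ^ (-(1 + 2 * ρ))) := by
        rw [← ENNReal.ofReal_add (by positivity) (by positivity), show -(1 + 2 * ρ) = -1 - 2 * ρ by ring]
        ring_nf

/-! ### The sharp past-exact / shifted twin -/

namespace Past

variable {ρ T T₁ : ℝ} {x₀ : EuclideanSpace ℝ (Fin 3)}
  {u : ℝ → EuclideanSpace ℝ (Fin 3) → EuclideanSpace ℝ (Fin 3)} {p : ℝ → EuclideanSpace ℝ (Fin 3) → ℝ}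
  {H : ℝ → EuclideanSpace ℝ (Fin 3) → EuclideanSpace ℝ (Fin 3) →L[ℝ] EuclideanSpace ℝ (Fin 3)} {c : ℝ≥0}
  {V : EuclideanSpace ℝ (Fin 3) → EuclideanSpace ℝ (Fin 3)} {P : EuclideanSpace ℝ (Fin 3) → ℝ}

/-- **Past-exact member, `C²` profile of linear growth with a SUPER-FAST FAR VORTICAL CHANNEL for every classical pressure: the profile is ZERO**
(`0 < ρ ≤ ½`; exact self-similarity about `(T, x₀)` for `τ < T₁ ≤ min 0 T`; no far-field pressure hypothesis). [folklore] -/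
theorem profile_eq_zero_of_vorticalSuperFastChannelC2 (hρ : 0 < ρ) (hρh : ρ ≤ 1 / 2) (hT₁ : T₁ ≤ 0) (hTT₁ : T₁ ≤ T)
    (hsol : IsDistributionalNSSolutionOn (slab (EuclideanSpace ℝ (Fin 3)) (Iio 0) isOpen_Iio) 0 0 u p)
    (hA : ∀ a : ℝ, 0 < a → ENNReal.ofReal (a ^ (2 * ρ)) *
      cknA a (0 : ℝ × EuclideanSpace ℝ (Fin 3)) u ≤ (c : ℝ≥0∞))
    (hD : ∀ a : ℝ, 0 < a → ENNReal.ofReal (a ^ (2 * ρ)) *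
      cknD a (0 : ℝ × EuclideanSpace ℝ (Fin 3)) p ≤ (c : ℝ≥0∞))
    (hu : ∀ τ : ℝ, τ < T₁ → u τ = fun x => selfSimilarCollapse (1 / (2 + ρ)) T V τ (x - x₀))
    (hp : ∀ τ : ℝ, τ < T₁ → p τ = fun x => selfSimilarCollapsePressure (1 / (2 + ρ)) T P τ (x - x₀))
    (hV : ContDiff ℝ 2 V) {K₁ : ℝ} (hK₁ : ∀ y : EuclideanSpace ℝ (Fin 3), ‖V y‖ ≤ K₁ * (1 + ‖y‖))
    {c₁ : ℝ} (hc₁ : 3 / ((2 + ρ) * (1 + 2 * ρ)) < c₁)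
    (hB : ∀ P' : EuclideanSpace ℝ (Fin 3) → ℝ, IsSelfSimilarEulerProfile (1 / (2 + ρ)) 0 V P' →
      ∀ h : ℝ, ∃ R₀ : ℝ, ∀ y : EuclideanSpace ℝ (Fin 3), R₀ ≤ ‖y‖ →
        h < selfSimilarBernoulli (1 / (2 + ρ)) 0 V P' y → curl V y ≠ 0 →
          ⟪y, selfSimilarTransport (1 / (2 + ρ)) 0 V y⟫ ≤ -(c₁ * ‖y‖ ^ 2)) : V = 0 := by
  -- adapted from `Past.profile_eq_zero_of_fastChannelC2` (…SqueezePast) and `Loc.…superFastChannelC2_profile` (…SqueezeSharp)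
  have hρ1' : ρ < 1 := by linarith
  have h2ρ : (0 : ℝ) < 2 + ρ := by linarith
  have hγ : (0 : ℝ) < 1 / (2 + ρ) := one_div_pos.2 h2ρ
  have hγ2 : 1 / (2 + ρ) < 1 / 2 := one_div_lt_one_div_of_lt two_pos (by linarith)
  -- the far-past extension and its dictionary
  have hext := Shifted.isDistributional_selfSimilarCollapse_of_past hT₁ hTT₁ x₀ hsol hu hp
  have hpmE : AEStronglyMeasurable (uncurry (selfSimilarCollapsePressure (1 / (2 + ρ)) 0 P))
      (volume.restrict (Iio (0 : ℝ) ×ˢ (univ : Set (EuclideanSpace ℝ (Fin 3))))) := by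
    have := hext.2.2.1.aestronglyMeasurable
    simpa [slab] using this
  have hPm : AEStronglyMeasurable P volume :=
    aestronglyMeasurable_pressureProfile (p := selfSimilarCollapsePressure (1 / (2 + ρ)) 0 P) hpmE fun _ _ => rfl
  have hP1 : LocallyIntegrable P volume :=
    Shifted.locallyIntegrable_pressureProfile_of_slab hγ.le (by linarith) hPm hext.2.2.1
  have hVm : AEStronglyMeasurable V volume := hV.continuous.aestronglyMeasurable
  obtain ⟨P', hprof⟩ := exists_isSelfSimilarEulerProfile hρ hT₁ hTT₁ hsol hu hp hV
  have hfast := hB P' hprof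
  -- the bridge on the extension: `P = P' + c₀` a.e.
  obtain ⟨c₀, hc₀⟩ := WeakToClassical.pressureProfile_ae_eq_add_const hext (fun _ _ => rfl) (fun _ _ => rfl) hV hP1 hprof
  -- growth-form `A`- and `D`-data of the profile
  obtain ⟨CA, hCA, hgrowth⟩ := Shifted.profile_energy_growth_of_gaugeA_past hρ hρh hT₁ hTT₁ x₀ hu hA
  obtain ⟨CA', hCA', hgrowth'⟩ := Shifted.growth_of_growth_le hV.continuous (θ := 1 - 2 * ρ) (by linarith)
    (L₀ := 2 - T₁) (by linarith) hCA hgrowth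
  have hA' : ∀ L : ℝ, 0 < L → ∫⁻ y in ball (0 : EuclideanSpace ℝ (Fin 3)) L, ‖V y‖ₑ ^ 2 ≤
      (CA'.toNNReal : ℝ≥0∞) * ENNReal.ofReal (L ^ (1 - 2 * ρ)) := by
    intro L hL; rw [ENNReal.coe_toNNReal hCA']; exact hgrowth' L hL
  have hpm : AEStronglyMeasurable (uncurry p)
      (volume.restrict (Iio (0 : ℝ) ×ˢ (univ : Set (EuclideanSpace ℝ (Fin 3))))) := by
    have := hsol.2.2.1.aestronglyMeasurable
    simpa [slab] using this
  obtain ⟨CD, hCD, hDgrowth⟩ := profile_pressure_growth_of_gaugeD_past hρ hρ1' hT₁ hTT₁ x₀ hpm hp hD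
  have hD' : ∀ L : ℝ, 2 - T₁ ≤ L → ∫⁻ y in ball (0 : EuclideanSpace ℝ (Fin 3)) L, ‖P y‖ₑ ^ (3 / 2 : ℝ) ≤
      (CD.toNNReal : ℝ≥0∞) * ENNReal.ofReal (L ^ (2 - 2 * ρ)) := by
    intro L hL; rw [ENNReal.coe_toNNReal hCD]; exact hDgrowth L hL
  -- thinness of `{ℋ_P > h + c₀}`, transferred to `{ℋ_{P'} > h}`
  have hthin : ∀ h : ℝ, ∃ C R₂ : ℝ, 0 < R₂ ∧ ∀ R : ℝ, R₂ ≤ R →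
      volume ({y : EuclideanSpace ℝ (Fin 3) | h < selfSimilarBernoulli (1 / (2 + ρ)) 0 V P' y} ∩ {y | R ≤ ‖y‖}) ≤
        ENNReal.ofReal (C * R ^ (-(1 + 2 * ρ))) := by
    intro h
    obtain ⟨Ch, R₂, hR₂, hfar⟩ := Loc.volume_bernoulliHigh_inter_far_le_of_growth hρ hVm hA' hPm hD' (h + c₀)
    refine ⟨Ch, R₂, hR₂, fun R hR => ?_⟩
    have hae : ∀ᵐ y ∂(volume : Measure (EuclideanSpace ℝ (Fin 3))),
        y ∈ ({y : EuclideanSpace ℝ (Fin 3) | h < selfSimilarBernoulli (1 / (2 + ρ)) 0 V P' y} ∩ {y | R ≤ ‖y‖}) →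
          y ∈ ({y : EuclideanSpace ℝ (Fin 3) | h + c₀ < selfSimilarBernoulli (1 / (2 + ρ)) 0 V P y} ∩ {y | R ≤ ‖y‖}) := by
      filter_upwards [hc₀] with y hy
      rintro ⟨h1, h2⟩
      refine ⟨?_, h2⟩
      simp only [mem_setOf_eq, selfSimilarBernoulli_apply] at h1 ⊢
      rw [hy]
      linarith
    exact (measure_mono_ae hae).trans (hfar R hR)
  have hrace : 3 * (1 / (2 + ρ)) < c₁ * (1 + 2 * ρ) := by
    have h12 : (0 : ℝ) < 1 + 2 * ρ := by linarith
    have h1 := (div_lt_iff₀ (by positivity : (0 : ℝ) < (2 + ρ) * (1 + 2 * ρ))).1 hc₁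
    rw [show 3 * (1 / (2 + ρ)) = 3 / (2 + ρ) by ring, div_lt_iff₀ h2ρ]
    nlinarith
  have hc₁0 : 0 < c₁ := lt_trans (by positivity) hc₁
  have hcurl : ∀ x, curl V x = 0 := fun x =>
    Loc.curl_eq_zero_of_vorticalFastChannel_of_thin hprof hγ hγ2 hK₁ hc₁0 hrace hthin hfast x
  exact profile_eq_zero_of_irrotationalC2 hρ hρh hT₁ hTT₁ hsol hA hu hp hV hcurl

/-- **PAST-EXACT MEMBER WHOSE `C²` PROFILE OF LINEAR GROWTH HAS A SUPER-FAST FAR VORTICAL CHANNEL IS TRIVIAL — channel bound only at vortical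
points, no far-field pressure hypothesis** (crux
hypotheses verbatim, `0 < ρ ≤ ½`, exact self-similarity about `(T, x₀)` for `τ < T₁`, `T₁ ≤ 0`, `T₁ ≤ T`; `V ∈ C²`, `‖V y‖ ≤ K₁(1+‖y‖)`; for every
classical pressure `P′` of `V` a far channel `⟪y, γy + V y⟫ ≤ −c₁‖y‖²` on every high Bernoulli set, `c₁ > 3/((2+ρ)(1+2ρ))`).  The past twin of
`Loc.selfSimilar_ae_eq_zero_of_vorticalSuperFastChannelC2_profile`. [folklore] -/
theorem selfSimilar_ae_eq_zero_of_vorticalSuperFastChannelC2_profile_past (hρ : 0 < ρ) (hρh : ρ ≤ 1 / 2) (hT₁ : T₁ ≤ 0)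
    (hTT₁ : T₁ ≤ T) (x₀ : EuclideanSpace ℝ (Fin 3))
    (hsw : IsSuitableWeakSolutionOn (slab (EuclideanSpace ℝ (Fin 3)) (Iio 0) isOpen_Iio) 0 0 u p)
    (hH : HasWeakSpatialGradientOn (slab (EuclideanSpace ℝ (Fin 3)) (Iio 0) isOpen_Iio) u H)
    (hgauge : ∀ a : ℝ, 0 < a →
      ENNReal.ofReal (a ^ (2 * ρ)) * cknA a (0 : ℝ × EuclideanSpace ℝ (Fin 3)) u +
          ENNReal.ofReal (a ^ ρ) * cknE a (0 : ℝ × EuclideanSpace ℝ (Fin 3)) H +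
        ENNReal.ofReal (a ^ (2 * ρ)) * cknD a (0 : ℝ × EuclideanSpace ℝ (Fin 3)) p ≤ (c : ℝ≥0∞))
    (hu : ∀ τ : ℝ, τ < T₁ → u τ = fun x => selfSimilarCollapse (1 / (2 + ρ)) T V τ (x - x₀))
    (hp : ∀ τ : ℝ, τ < T₁ → p τ = fun x => selfSimilarCollapsePressure (1 / (2 + ρ)) T P τ (x - x₀))
    (hV : ContDiff ℝ 2 V) {K₁ : ℝ} (hK₁ : ∀ y : EuclideanSpace ℝ (Fin 3), ‖V y‖ ≤ K₁ * (1 + ‖y‖))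
    {c₁ : ℝ} (hc₁ : 3 / ((2 + ρ) * (1 + 2 * ρ)) < c₁)
    (hB : ∀ P' : EuclideanSpace ℝ (Fin 3) → ℝ, IsSelfSimilarEulerProfile (1 / (2 + ρ)) 0 V P' →
      ∀ h : ℝ, ∃ R₀ : ℝ, ∀ y : EuclideanSpace ℝ (Fin 3), R₀ ≤ ‖y‖ →
        h < selfSimilarBernoulli (1 / (2 + ρ)) 0 V P' y → curl V y ≠ 0 →
          ⟪y, selfSimilarTransport (1 / (2 + ρ)) 0 V y⟫ ≤ -(c₁ * ‖y‖ ^ 2)) :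
    uncurry u =ᵐ[volume.restrict (Iio (0 : ℝ) ×ˢ (univ : Set (EuclideanSpace ℝ (Fin 3))))] 0 :=
  have hA : ∀ a : ℝ, 0 < a → ENNReal.ofReal (a ^ (2 * ρ)) *
      cknA a (0 : ℝ × EuclideanSpace ℝ (Fin 3)) u ≤ (c : ℝ≥0∞) :=
    fun a ha => le_trans (le_trans le_self_add le_self_add) (hgauge a ha)
  have hD : ∀ a : ℝ, 0 < a → ENNReal.ofReal (a ^ (2 * ρ)) *
      cknD a (0 : ℝ × EuclideanSpace ℝ (Fin 3)) p ≤ (c : ℝ≥0∞) :=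
    fun a ha => le_trans le_add_self (hgauge a ha)
  ae_eq_zero_of_profile_eq_zero hρ.le hsw hH hgauge hu
    (profile_eq_zero_of_vorticalSuperFastChannelC2 hρ hρh hT₁ hTT₁ hsw.distributional hA hD hu hp hV hK₁ hc₁ hB)

end Past

end Summit.NavierStokesRegularity.NavierStokesRegularity.Theorems.PowerGaugeEulerLiouville

end
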